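import Mathlib
import Summits.NavierStokesRegularity.NavierStokesRegularity.Theorems.FilamentSkeletonRssSkeletonJ1RLiaSelfWindow

/-!
# Crux `SkeletonJ1R` (stmt-NavierStokesRegularity-23610) · line `streamline_kantorovich_R` · toward stub F2-d (`LiaDefectDerivBL`, v7), frame brick for S2′/S3′ of B1′:
# THE LOGARITHMIC-WINDOW MAJORANT FRAME FOR AN ARBITRARY INTEGRAND AND AN ARBITRARY FROZEN VECTOR

Hand `leafhand-ns-filamentskeletonrs-1` (gen 0), `--supports stmt-NavierStokesRegularity-23610 --as helper`.  MODEL rung, NEGATIVE side of the ladder: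
kernel calculus for a HYPOTHETICAL filament-type blow-up skeleton; nothing here is a claim about Navier–Stokes regularity; the stub and the crux stay OPEN.

`integral_sub_windowModel_le_of_majorant` — the frame lemma of brick S2 (`…LiaSelfWindow.selfStrand_sub_lia_le_of_majorant`) with the self-strand integrand
replaced by an arbitrary a.e.-strongly-measurable `F : ℝ → ℝ³` and the frozen vector `X′τ × X″τ` by an arbitrary `V`: if
`‖F σ − 𝟙_{[τ−R, τ+R]}(σ)·K_e(σ−τ)((σ−τ)²/2)•V‖ ≤ m σ` with `m` integrable, then `F` is integrable and `‖∫F − Λ_e(R)•V‖ ≤ ∫ m`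
(`Λ_e(R) = arsinh(R/e) − R/√(R²+e²)` the Rosenhead window coefficient, `…LiaSelfWindow.integral_window_model`).  For B1′ it is used with `F` = the
symmetrized derivative integrand `D` of `…LiaSelfDerivSymm` and `V = X′τ × X‴τ`, the local-induction term of `Ȧ_j` being `Λ_e(R)•X′τ × X‴τ`.
-/

set_option linter.dupNamespace false -- `NavierStokesRegularity.NavierStokesRegularity` path/namespace repetition is the tree convention

noncomputable section

namespace Summit.NavierStokesRegularity.NavierStokesRegularity.Theorems.SkeletonJ1RLiaSelf

open Set Function Filter Real Topology MeasureTheory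
open Literature.Analysis.FluidPDE
open scoped InnerProductSpace BigOperators

/-- **Window-model majorant frame, general integrand and frozen vector** (see the module docstring). [folklore] -/
theorem integral_sub_windowModel_le_of_majorant {F : ℝ → EuclideanSpace ℝ (Fin 3)} (hF : AEStronglyMeasurable F)
    (V : EuclideanSpace ℝ (Fin 3)) {e : ℝ} (he : 0 < e) (τ : ℝ) {R : ℝ} (hR : 0 ≤ R) {m : ℝ → ℝ} (hm : Integrable m)
    (hmaj : ∀ σ, ‖F σ - (Icc (τ - R) (τ + R)).indicator
          (fun σ => (((((σ - τ) ^ 2 + e ^ 2) ^ (3 / 2 : ℝ))⁻¹ * ((σ - τ) ^ 2 / 2)) • V)) σ‖ ≤ m σ) :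
    Integrable F ∧ ‖(∫ σ, F σ) - (Real.arsinh (R / e) - R / Real.sqrt (R ^ 2 + e ^ 2)) • V‖ ≤ ∫ σ, m σ := by
  set G : ℝ → EuclideanSpace ℝ (Fin 3) := (Icc (τ - R) (τ + R)).indicator
    (fun σ => (((((σ - τ) ^ 2 + e ^ 2) ^ (3 / 2 : ℝ))⁻¹ * ((σ - τ) ^ 2 / 2)) • V)) with hG
  -- the model is integrable and integrates to Λ • V
  have hgc : Continuous fun σ : ℝ => (((σ - τ) ^ 2 + e ^ 2) ^ (3 / 2 : ℝ))⁻¹ * ((σ - τ) ^ 2 / 2) := by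
    refine Continuous.mul ?_ (((continuous_id.sub continuous_const).pow 2).div_const 2)
    exact ((((continuous_id.sub continuous_const).pow 2).add continuous_const).rpow_const
      fun _ => Or.inr (by norm_num)).inv₀
      fun σ => (Real.rpow_pos_of_pos (by positivity : (0:ℝ) < (σ - τ) ^ 2 + e ^ 2) _).ne'
  have hWc : Continuous fun σ : ℝ => (((((σ - τ) ^ 2 + e ^ 2) ^ (3 / 2 : ℝ))⁻¹ * ((σ - τ) ^ 2 / 2)) • V) := hgc.smul continuous_const
  have hGint : Integrable G := (hWc.integrableOn_Icc (a := τ - R) (b := τ + R)).integrable_indicator measurableSet_Icc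
  have hGval : ∫ σ, G σ = (Real.arsinh (R / e) - R / Real.sqrt (R ^ 2 + e ^ 2)) • V := by
    rw [hG, MeasureTheory.integral_indicator measurableSet_Icc, integral_Icc_eq_integral_Ioc,
      ← intervalIntegral.integral_of_le (by linarith : τ - R ≤ τ + R),
      intervalIntegral.integral_smul_const, integral_window_model he τ hR]
  -- F = (F − G) + G is integrable
  have hdiff_int : Integrable (fun σ => F σ - G σ) :=
    Integrable.mono' hm (hF.sub hGint.aestronglyMeasurable) (Eventually.of_forall hmaj)
  have hFint : Integrable F := by
    have h := hdiff_int.add hGint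
    have heq : ((fun σ => F σ - G σ) + G) = F := by
      funext σ; simp only [Pi.add_apply, sub_add_cancel]
    rwa [heq] at h
  refine ⟨hFint, ?_⟩
  rw [← hGval, ← integral_sub hFint hGint]
  exact norm_integral_le_of_norm_le hm (Eventually.of_forall hmaj)

/-- **Continuity of the symmetrized self-strand derivative integrand** (for a `C²` curve, core `q > 0`, any direction `P`) — the measurability input of
the frame lemma. [folklore] -/
theorem continuous_symmDerivIntegrand {X : ℝ → EuclideanSpace ℝ (Fin 3)} (hX : ContDiff ℝ 2 X) {q : ℝ} (hq : 0 < q) (τ : ℝ)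
    (P : EuclideanSpace ℝ (Fin 3)) :
    Continuous fun σ : ℝ => (-3 * ⟪X τ - X σ, P - deriv X σ⟫_ℝ * ((‖X τ - X σ‖ ^ 2 + q) ^ (5 / 2 : ℝ))⁻¹) • cross (deriv X σ) (X τ - X σ) +
      ((‖X τ - X σ‖ ^ 2 + q) ^ (3 / 2 : ℝ))⁻¹ • (cross (deriv X σ) (P - deriv X σ) + cross (deriv (deriv X) σ) (X τ - X σ)) := by
  have hXc : Continuous X := hX.continuous
  have hdc : Continuous (deriv X) := hX.continuous_deriv (by norm_num)
  have hd2c : Continuous (deriv (deriv X)) := continuous_deriv_two hX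
  have hb : ∀ u : ℝ, 0 < ‖X τ - X u‖ ^ 2 + q := fun u => by positivity
  have hwc : Continuous fun u : ℝ => X τ - X u := continuous_const.sub hXc
  have hk3 : Continuous fun u : ℝ => ((‖X τ - X u‖ ^ 2 + q) ^ (3 / 2 : ℝ))⁻¹ :=
    (((hwc.norm.pow 2).add continuous_const).rpow_const fun u => Or.inr (by norm_num)).inv₀ fun u => (Real.rpow_pos_of_pos (hb u) _).ne'
  have hk5 : Continuous fun u : ℝ => ((‖X τ - X u‖ ^ 2 + q) ^ (5 / 2 : ℝ))⁻¹ :=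
    (((hwc.norm.pow 2).add continuous_const).rpow_const fun u => Or.inr (by norm_num)).inv₀ fun u => (Real.rpow_pos_of_pos (hb u) _).ne'
  have hPc : Continuous fun u : ℝ => P - deriv X u := continuous_const.sub hdc
  have hcr1 : Continuous fun u : ℝ => cross (deriv X u) (X τ - X u) := (crossCLM.continuous.comp hdc).clm_apply hwc
  have hcr2 : Continuous fun u : ℝ => cross (deriv X u) (P - deriv X u) := (crossCLM.continuous.comp hdc).clm_apply hPc
  have hcr3 : Continuous fun u : ℝ => cross (deriv (deriv X) u) (X τ - X u) := (crossCLM.continuous.comp hd2c).clm_apply hwc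
  exact (((continuous_const.mul (hwc.inner hPc)).mul hk5).smul hcr1).add (hk3.smul (hcr2.add hcr3))

end Summit.NavierStokesRegularity.NavierStokesRegularity.Theorems.SkeletonJ1RLiaSelf

end
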